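import Summits.QuantumFields.YangMills.Theorems.BalabanUVNodesN18CombStepSharp2RecordLetters
import Summits.QuantumFields.YangMills.Theorems.BalabanUVNodesN18CombStepSharpLetters
import HarnessLib

/-!
# BalabanUVNodes ∕ node N18 = NE5 — closure-ledger item (iii), comb step M4c, file (6h):
# THE RECORD LETTERS WITH THE BEST OF BOTH C¹ SUMS — `S₁min = min(S₁, S₁♯)` ((5b)'s crude-remainder sum for small j, (6f)'s coarse-Lipschitz sum for large j)

(Track A, DAG node N18 = `T4OutputRate.NE5`; cluster K4 «SpineRates», key item K3⁸ `SpineGivenEndpointR13SepCoPHV` (stmt-QuantumFields-27366);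
seat pub-ymgap-dag-n18-w3 g5, INTENT-6 = design step M4c.)  Count-neutral helper (`--supports stmt-QuantumFields-27366 --as helper`); K3⁸∕K3⁷ NOT claimed,
NOT closed; YM mass gap (Clay) NOT proved by any of this; R4 closes the conditional finite-𝕋⁴ rung `BalabanLadder.UV` only.

WHY (NUMERICS-M4C.md).  (6f)'s `S₁♯` is K-uniform (every side term `O(η_j)`) but its envelope constant `8·10⁵ℓ²` makes it WORSE than (5b)'s `S₁` (with the `2R∕ξ²` floor)
at `j ≤ 2`; both letters pin down THE SAME comb generator `l` (formula (0)), so both C¹ bounds hold for it and the record may use `min(S₁, S₁♯)` per step.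
WHAT.  `comb_letters_min_TΦOfRecord`: (6f)'s seven letters with (5♯♯) `≤ min(S₁, S₁♯)` and (6♯) `≤ min(S₁, S₁♯) + 2D₁∕ξ` (from (5b) `comb_letters_sharp_TΦOfRecord` and
(6f) `comb_letters_sharp2_TΦOfRecord`, `funext` on formula (0), `le_min`, `min_add_add_right`).  Displayed numerics: those of (6f) (`0 < t`, `384ℓσ ≤ 1` imply (5b)'s `136ℓσ ≤ 1`).

0 `def`, 0 `sorry`.  References: T. Bałaban, CMP **98** (1985) [Balaban1985Averaging] (Prop. 3 (122)–(126) p.36, (62)–(63) p.28); CMP **109** (1987) [Balaban1987RG1]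
((0.4) p.253, (0.24)–(0.25) p.257, (1.10)–(1.16) p.262, (2.17) p.269); C. King, CMP **102** (1986) [King1986] ((3.43)–(3.47) p.661).
-/

noncomputable section

open scoped BigOperators Matrix.Norms.L2Operator
open NormedSpace

namespace YMDAG.N18.TransportOfRecord

open Complex (I)
open Literature.MathematicalPhysics.QuantumFieldTheory.Balaban1983to89
open Literature.MathematicalPhysics.QuantumFieldTheory.Balaban1983to89.T4Continuum
open Literature.MathematicalPhysics.QuantumFieldTheory.Balaban1983to89.T4LevelShift
open Literature.MathematicalPhysics.QuantumFieldTheory.Balaban1983to89.BlockAveraging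
open Literature.MathematicalPhysics.QuantumFieldTheory.Balaban1983to89.BlockAveragingEMLLinearised (combMean)
open Literature.MathematicalPhysics.QuantumFieldTheory.Balaban1983to89.B12RegularSpaces111
open Literature.MathematicalPhysics.QuantumFieldTheory.Balaban1983to89.B12RegularSpaces111SpecialUnitary (suModel mem_suModel_G mem_suModel_gc suModel_norm_le)
open Literature.MathematicalPhysics.QuantumFieldTheory.Balaban1983to89.MatrixLog (mlog)
open Literature.MathematicalPhysics.QuantumFieldTheory.Balaban1983to89.B7Prop1Explicit (U1 mem_U1)
open Literature.MathematicalPhysics.QuantumFieldTheory.Balaban1983to89.B10Eq27TorusAxialLog (axialT)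
open Literature.MathematicalPhysics.QuantumFieldTheory.Balaban1983to89.T4TermwiseBCH (norm_units_conj_le)
open Literature.MathematicalPhysics.QuantumFieldTheory.Balaban1983to89.Node00 (MatA)
open Literature.MathematicalPhysics.QuantumFieldTheory.Balaban1983to89.Node00.Sect2 (regionOfSet domSys domSites frameI Residual)
open Literature.MathematicalPhysics.QuantumFieldTheory.Balaban1983to89.Node00.W1
open YMDAG.N18.AvgPotential (twoBlocks_subset_bonds_preimage)
open YMDAG.N18.TwoRunCubes (ladder domSites_pairOfRecord_eq_preimage)

section Record

variable {F : T4Family} {N : ℕ} [NeZero N] {M k : ℕ}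

/-- **THE COMB GENERATOR OF RECORD WITH `min(S₁, S₁♯)`.**  Per table point `(j, Y)` and run-B data: (6f)'s letters (0)–(4), (5) `‖∇^ξ(Pot − i∇l)‖ ≤ min(S₁, S₁♯)`,
(6) `‖∇^ξ Pot‖ ≤ min(S₁, S₁♯) + 2D₁∕ξ` on the frame's direction pairs (`S₁` = (4e)/(5b)'s sum with `2(R∕ξ + (η∕ξ)69ℓ²tα₁B)`, `S₁♯` = (6e)/(6f)'s coarse-Lipschitz sum).
[cite: Balaban1985Averaging, Prop. 3 (122)-(126) p.36, (62)-(63) p.28; Balaban1987RG1, (0.4) p.253, (0.24)-(0.25) p.257, (1.10)-(1.16) p.262, (2.17) p.269; King1986, (3.43)-(3.47) p.661] -/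
theorem comb_letters_min_TΦOfRecord (Rz : Residual (F.P (k + 1)) (MatA N)) (j : ℕ) (Y : (domSys (F.P k) M j).Dom)
    [DecidablePred (· ∈ (frameI Rz M (j + 1) (domSites (F.P (k + 1)) M (j + 1) (pairOfRecord F M k ⟨j, Y⟩).2)).X.bonds)] {cB : StepConsts} {α₀B α₁B : ℝ}
    {Φ : FieldPair (F.P (k + 1)) 0 (MatA N)ˣ (MatA N)} {U : PBond (F.P (k + 1)) 0 → (MatA N)ˣ} {A' : PBond (F.P (k + 1)) 0 → MatA N}
    (hcBξ : cB.ξ = (F.P (k + 1)).eta (j + 1))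
    (hf : Factors cB Φ.U U A')
    (hI : CondI (suModel N) (frameI Rz M (j + 1) (domSites (F.P (k + 1)) M (j + 1) (pairOfRecord F M k ⟨j, Y⟩).2)) cB α₀B U)
    (hII : CondII (suModel N) (frameI Rz M (j + 1) (domSites (F.P (k + 1)) M (j + 1) (pairOfRecord F M k ⟨j, Y⟩).2)).X cB α₁B U A')
    (hα0 : 0 ≤ α₀B) (hα1 : 0 ≤ α₁B) (hξ₁ : (F.P (k + 1)).eta (j + 1) * α₁B ≤ 1 / 4) {t : ℝ}
    (hRt : (((((F.P (k + 1)).d + 4) * (F.P (k + 1)).L : ℕ) : ℝ) / 2) * (α₀B * (F.P (k + 1)).eta (j + 1) ^ 2) ≤ t)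
    (ht : 0 < t) (hℓ : 384 * (((((F.P (k + 1)).d + 2) * (F.P (k + 1)).L : ℕ) : ℝ)) *
      ((2 * ((F.P (k + 1)).eta (j + 1) * α₁B) + t + 2 * ((F.P (k + 1)).eta (j + 1) * α₁B) * t) + t) ≤ 1)
    (hUA1 : ∀ b ∈ (frameI (Residual.unit (F.P k) (MatA N)) M j (domSites (F.P k) M j Y)).X.bonds,
      fieldShift (ladder F k) (avgUnits U) b ∈ U1 (MatA N)) :
    let X := (frameI Rz M (j + 1) (domSites (F.P (k + 1)) M (j + 1) (pairOfRecord F M k ⟨j, Y⟩).2)).X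
    let AX : PBond (F.P (k + 1)) 0 → MatA N := fun b => if b ∈ X.bonds then A' b else 0
    let UA : PBond (F.P k) 0 → (MatA N)ˣ := fieldShift (ladder F k) (avgUnits U)
    let R : ℝ := (4 * (34 * (((((F.P (k + 1)).d + 2) * (F.P (k + 1)).L : ℕ) : ℝ)) * ((2 * ((F.P (k + 1)).eta (j + 1) * α₁B) + t + 2 * ((F.P (k + 1)).eta (j + 1) * α₁B) * t) + t)) ^ 2 +
        578 * (((((F.P (k + 1)).d + 2) * (F.P (k + 1)).L : ℕ) : ℝ)) ^ 2 * ((2 * ((F.P (k + 1)).eta (j + 1) * α₁B) + t + 2 * ((F.P (k + 1)).eta (j + 1) * α₁B) * t) + t) * t +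
        660 * (((((F.P (k + 1)).d + 2) * (F.P (k + 1)).L : ℕ) : ℝ)) ^ 2 * ((2 * ((F.P (k + 1)).eta (j + 1) * α₁B) + t + 2 * ((F.P (k + 1)).eta (j + 1) * α₁B) * t) ^ 2 + t ^ 2) +
        3 * (((((F.P (k + 1)).d + 2) * (F.P (k + 1)).L : ℕ) : ℝ)) * (2 * ((F.P (k + 1)).eta (j + 1) * α₁B) * t) +
        3 * (((((F.P (k + 1)).d + 2) * (F.P (k + 1)).L : ℕ) : ℝ)) * ((F.P (k + 1)).eta (j + 1) * α₁B) ^ 2)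
    let S₀ : ℝ := (F.P (k + 1)).eta (j + 1) / (F.P k).eta j * (((F.P (k + 1)).L : ℝ) * α₁B) + R / (F.P k).eta j +
      (F.P (k + 1)).eta (j + 1) / (F.P k).eta j * (69 * (((((F.P (k + 1)).d + 2) * (F.P (k + 1)).L : ℕ) : ℝ)) ^ 2 * t * α₁B)
    let S₁ : ℝ := ((F.P k).eta j)⁻¹ * ((F.P (k + 1)).eta (j + 1) / (F.P k).eta j * ((F.P (k + 1)).L : ℝ) * (69 * (((((F.P (k + 1)).d + 2) * (F.P (k + 1)).L : ℕ) : ℝ)) * t * α₁B + ((F.P (k + 1)).L : ℝ) * ((F.P (k + 1)).eta (j + 1) * α₁B + 2 * t * α₁B)) +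
      2 * ((F.P (k + 1)).eta (j + 1) / (F.P k).eta j * (69 * (((((F.P (k + 1)).d + 2) * (F.P (k + 1)).L : ℕ) : ℝ)) ^ 2 * t * α₁B)) +
      (4 * (17 * (((((F.P (k + 1)).d + 2) * (F.P (k + 1)).L : ℕ) : ℝ)) * t) * (R / (F.P k).eta j + (F.P (k + 1)).eta (j + 1) / (F.P k).eta j * (3 * (((((F.P (k + 1)).d + 2) * (F.P (k + 1)).L : ℕ) : ℝ)) ^ 2 * t * α₁B)) +
        (F.P (k + 1)).eta (j + 1) / (F.P k).eta j * (3 * (((((F.P (k + 1)).d + 2) * (F.P (k + 1)).L : ℕ) : ℝ)) ^ 2 * t * α₁B) +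
        ((F.P k).eta j)⁻¹ * (800000 * (((((F.P (k + 1)).d + 2) * (F.P (k + 1)).L : ℕ) : ℝ)) ^ 2 * ((2 * ((F.P (k + 1)).eta (j + 1) * α₁B) + t + 2 * ((F.P (k + 1)).eta (j + 1) * α₁B) * t) + t) * ((F.P (k + 1)).eta (j + 1) * (((F.P (k + 1)).L : ℝ) * ((F.P (k + 1)).eta (j + 1) * α₁B + 2 * t * α₁B)) + 2 * t))))
    let S₁' : ℝ := ((F.P k).eta j)⁻¹ * ((F.P (k + 1)).eta (j + 1) / (F.P k).eta j * ((F.P (k + 1)).L : ℝ) *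
        (69 * (((((F.P (k + 1)).d + 2) * (F.P (k + 1)).L : ℕ) : ℝ)) * t * α₁B + ((F.P (k + 1)).L : ℝ) * ((F.P (k + 1)).eta (j + 1) * α₁B + 2 * t * α₁B)) +
      2 * (R / (F.P k).eta j + (F.P (k + 1)).eta (j + 1) / (F.P k).eta j * (69 * (((((F.P (k + 1)).d + 2) * (F.P (k + 1)).L : ℕ) : ℝ)) ^ 2 * t * α₁B)))
    let D₁ : ℝ := (F.P (k + 1)).eta (j + 1) / (F.P k).eta j *
      (69 * (((((F.P (k + 1)).d + 2) * (F.P (k + 1)).L : ℕ) : ℝ)) ^ 2 * t * α₁B +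
        (((((F.P (k + 1)).d + 2) * (F.P (k + 1)).L : ℕ) : ℝ)) * (((F.P (k + 1)).L : ℝ) * ((F.P (k + 1)).eta (j + 1) * α₁B + 2 * t * α₁B)))
    ∃ l : Site (F.P k) 0 → MatA N,
    (∀ x, l x = (I * ((F.P (k + 1)).eta (j + 1) : ℂ)) • combMean (adJ (axialT U (emb (siteShift (ladder F k) x))) AX) (siteShift (ladder F k) x)) ∧
    (∀ x, Matrix.trace (l x) = 0) ∧
    (∀ x ∈ domSites (F.P k) M j Y, ‖l x‖ ≤ (F.P (k + 1)).eta (j + 1) * ((((((F.P (k + 1)).d + 2) * (F.P (k + 1)).L : ℕ) : ℝ)) * α₁B)) ∧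
    (∀ (x : Site (F.P k) 0) (μ : Fin (F.P k).d), x ∈ domSites (F.P k) M j Y → x.shift μ ∈ domSites (F.P k) M j Y → ‖nabla ((F.P k).eta j) UA μ l x‖ ≤ D₁) ∧
    (∀ b ∈ (frameI (Residual.unit (F.P k) (MatA N)) M j (domSites (F.P k) M j Y)).X.bonds,
      ‖(I * ((F.P k).eta j : ℂ))⁻¹ • mlog ((((TΦOfRecord F N k Φ).U b : (MatA N)ˣ) : MatA N) * (((UA b)⁻¹ : (MatA N)ˣ) : MatA N)) -
        I • nabla ((F.P k).eta j) UA b.dir l b.src‖ ≤ S₀) ∧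
    (∀ q ∈ (frameI (Residual.unit (F.P k) (MatA N)) M j (domSites (F.P k) M j Y)).X.dpairs,
      ‖nabla ((F.P k).eta j) UA q.2.1
          (fun y => (I * ((F.P k).eta j : ℂ))⁻¹ • mlog ((((TΦOfRecord F N k Φ).U ⟨y, q.2.2⟩ : (MatA N)ˣ) : MatA N) * (((UA ⟨y, q.2.2⟩)⁻¹ : (MatA N)ˣ) : MatA N)) -
            I • nabla ((F.P k).eta j) UA q.2.2 l y) q.1‖ ≤ min S₁' S₁) ∧
    (∀ q ∈ (frameI (Residual.unit (F.P k) (MatA N)) M j (domSites (F.P k) M j Y)).X.dpairs,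
      ‖nabla ((F.P k).eta j) UA q.2.1
          (fun y => (I * ((F.P k).eta j : ℂ))⁻¹ • mlog ((((TΦOfRecord F N k Φ).U ⟨y, q.2.2⟩ : (MatA N)ˣ) : MatA N) * (((UA ⟨y, q.2.2⟩)⁻¹ : (MatA N)ˣ) : MatA N))) q.1‖ ≤
        min S₁' S₁ + 2 * D₁ / (F.P k).eta j) := by
  intro X AX UA R S₀ S₁ S₁' D₁
  have hη : 0 < (F.P (k + 1)).eta (j + 1) := pow_pos (inv_pos.mpr (Nat.cast_pos.mpr (F.P (k + 1)).L_pos)) _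
  have hℓ136 : 136 * (((((F.P (k + 1)).d + 2) * (F.P (k + 1)).L : ℕ) : ℝ)) *
      ((2 * ((F.P (k + 1)).eta (j + 1) * α₁B) + t + 2 * ((F.P (k + 1)).eta (j + 1) * α₁B) * t) + t) ≤ 1 := by
    have h0 : 0 ≤ (((((F.P (k + 1)).d + 2) * (F.P (k + 1)).L : ℕ) : ℝ)) *
        ((2 * ((F.P (k + 1)).eta (j + 1) * α₁B) + t + 2 * ((F.P (k + 1)).eta (j + 1) * α₁B) * t) + t) := by
      have := hη.le; have := ht.le; positivity
    nlinarith only [hℓ, h0]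
  -- (6f) and (5b): the same `l` (formula (0)), two C¹ letters
  obtain ⟨l, hl, hltr, hl0, hl1, hS0, hS1, hA1⟩ := comb_letters_sharp2_TΦOfRecord (M := M) (k := k) Rz j Y (Φ := Φ) hcBξ hf hI hII hα0 hα1 hξ₁ hRt ht hℓ hUA1
  obtain ⟨l', hl', -, -, -, -, hS1', hA1'⟩ := comb_letters_sharp_TΦOfRecord (M := M) (k := k) Rz j Y (Φ := Φ) hcBξ hf hI hII hα0 hα1 hξ₁ hRt hℓ136 hUA1
  have hll' : l' = l := funext fun x => by rw [hl' x, hl x]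
  rw [hll'] at hS1'
  refine ⟨l, hl, hltr, hl0, hl1, hS0, fun q hq => le_min (hS1' q hq) (hS1 q hq), fun q hq => ?_⟩
  rw [← min_add_add_right]
  exact le_min (hA1' q hq) (hA1 q hq)

end Record

end YMDAG.N18.TransportOfRecord

end
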